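import Summits.Parity.GeneralizedHardyLittlewood.Theorems.BeyondDiagonalBeatsQuarter.OffDiagDualHyperbolaSharp
import HarnessLib

/-!
# Route `PrimeLevelFamEdge`, crux K_B (stmt-Parity-20343), line `diagonal_kernel_split` rev 4, plan Ω,
# worker key L3 (part 6a) `OffDiagDualHyperbolaCentred`: the hyperbola count with the `s`-range CENTRED at
# `−n₀/c` — `#{(h₁,h₂) ∈ [-A₁,A₁]×[-A₂,A₂] : h₁h₂ ≡ n₀ (mod c)} ≤ (2A₁A₂/c + 1)·2C_δ·(A₁A₂)^δ`, uniformly in `n₀`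

`OffDiagDualHyperbolaSharp` parametrises `h₁h₂ = n₀ + cs` with `|s| ≤ (A₁A₂+|n₀|)/c`; for the dual boxes of
BLUEPRINT §2 one has `n₀ = αβ` up to `q^{Δ′}` while `A₁A₂/(qr)` is only `≍ r(1+Z)²q^{2ε}`, so the `|n₀|/c` in the
`s`-range would cost `q^{η}·(…)` in the ledger total (a spurious `κ₀ = 3/2`). Since `h₁h₂ ∈ [-A₁A₂, A₁A₂]`, in fact
`s ∈ [⌈(−A₁A₂−n₀)/c⌉, ⌊(A₁A₂−n₀)/c⌋]`, an interval of `≤ 2A₁A₂/c + 1` integers whatever `n₀` is, and on it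
`|n₀ + cs| ≤ A₁A₂`:
* **`card_hyperbolaBox_le_sum_card_divisors_centred`** — `≤ Σ_{s = −⌊(A₁A₂+n₀)/c⌋}^{⌊(A₁A₂−n₀)/c⌋} 2τ(|n₀+cs|)` (`c ∤ n₀`);
* **`card_hyperbolaBox_le_centred`** — `≤ (2A₁A₂/c + 1)·2C·(A₁A₂)^δ` with the divisor bound `τ(n) ≤ Cn^δ`;
* **`sum_dualCount_box_le_centred`**, **`sum_dualBox_norm_le_centred`** — the multiplicities summed over a dual box
  on every stratum, `≤ gcd(a,c)·(2A₁A₂/c+1)·2C(A₁A₂)^δ`, and the trivial ledger of one truncated dual box: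
  `Σ_{box} ‖Φ̂_i(h/(qr))‖·N ≤ bulk·gcd(α,qr)·(2A₁A₂/(qr)+1)·2C(A₁A₂)^δ` — «bulk × hyperbola density `A₁A₂/(qr)`».
Elementary counting; nothing about the heart. Helper (`--supports stmt-Parity-20343`); standard axioms.
«The programme SEARCHES and TYPES; no claim about Landau–Siegel zeros, Theorems 1–2 of arXiv:2211.02515 or
a repaired Margin232 until a kernel theorem says so.»
-/

noncomputable section

open Finset
open scoped Real

namespace Summit.Parity.GeneralizedHardyLittlewood.Theorems.BeyondDiagonalBeatsQuarter.OffDiag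

open Literature.NumberTheory.LFunctions Literature.NumberTheory.LFunctions.KMV2000
open Literature.Analysis.FunctionSpaces (besselJ)
open Literature.NumberTheory.Sieve.FriedlanderIwaniecPrimes (fourier2)

/-! ### §1. The centred `s`-range -/

/-- **The sharp hyperbola count, centred.** For `c ≥ 1`, `A₁, A₂ ∈ ℕ`, `n₀ ∈ ℤ` with `c ∤ n₀`:
`#{(h₁,h₂) ∈ [-A₁,A₁]×[-A₂,A₂] : h₁h₂ ≡ n₀ (mod c)} ≤ Σ_{s ∈ [−⌊(A₁A₂+n₀)/c⌋, ⌊(A₁A₂−n₀)/c⌋]} 2·τ(|n₀ + cs|)`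
(`h₁h₂ = n₀ + cs ∈ [-A₁A₂, A₁A₂]`; `h₂` is determined by `(s, h₁)`, `h₁ ∣ n₀ + cs ≠ 0`).
[cite: KowalskiMichelVanderKam2000, Lemma 3.3 p. 9 — derivation] -/
theorem card_hyperbolaBox_le_sum_card_divisors_centred (c : ℕ) (hc : 0 < c) (A₁ A₂ : ℕ) {n₀ : ℤ}
    (hn : ¬ (c : ℤ) ∣ n₀) :
    (((Finset.Icc (-(A₁ : ℤ)) A₁) ×ˢ (Finset.Icc (-(A₂ : ℤ)) A₂)).filter
        (fun h : ℤ × ℤ ↦ ((h.1 * h.2 : ℤ) : ZMod c) = (n₀ : ZMod c))).card ≤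
      ∑ s ∈ Finset.Icc (-(((A₁ : ℤ) * A₂ + n₀) / c)) (((A₁ : ℤ) * A₂ - n₀) / c),
        2 * ((n₀ + c * s).natAbs.divisors.card) := by
  classical
  have hcz : (0 : ℤ) < c := by exact_mod_cast hc
  set S := ((Finset.Icc (-(A₁ : ℤ)) A₁) ×ˢ (Finset.Icc (-(A₂ : ℤ)) A₂)).filter
    (fun h : ℤ × ℤ ↦ ((h.1 * h.2 : ℤ) : ZMod c) = (n₀ : ZMod c)) with hSdef
  set sOf : ℤ × ℤ → ℤ := fun h ↦ (h.1 * h.2 - n₀) / c with hsOf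
  have hmem : ∀ h ∈ S, (-(A₁ : ℤ) ≤ h.1 ∧ h.1 ≤ A₁) ∧ (-(A₂ : ℤ) ≤ h.2 ∧ h.2 ≤ A₂) ∧
      (c : ℤ) ∣ h.1 * h.2 - n₀ := by
    intro h hh
    obtain ⟨hbox, hcong⟩ := Finset.mem_filter.1 hh
    obtain ⟨h1, h2⟩ := Finset.mem_product.1 hbox
    refine ⟨Finset.mem_Icc.1 h1, Finset.mem_Icc.1 h2, ?_⟩
    exact (ZMod.intCast_eq_intCast_iff_dvd_sub n₀ (h.1 * h.2) c).1 (by push_cast at hcong ⊢; exact hcong.symm)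
  have hprod : ∀ h ∈ S, h.1 * h.2 = n₀ + c * sOf h := by
    intro h hh
    have hd := (hmem h hh).2.2
    rw [hsOf]; simp only
    rw [Int.mul_ediv_cancel' hd]; ring
  have hne : ∀ h ∈ S, h.1 * h.2 ≠ 0 := by
    intro h hh h0
    apply hn
    have hd := (hmem h hh).2.2
    rw [h0, zero_sub] at hd
    exact (dvd_neg).1 hd
  have h1ne : ∀ h ∈ S, h.1 ≠ 0 := fun h hh h0 ↦ hne h hh (by rw [h0, zero_mul])
  -- the centred range of `s`
  have habs : ∀ h ∈ S, -((A₁ : ℤ) * A₂) ≤ h.1 * h.2 ∧ h.1 * h.2 ≤ (A₁ : ℤ) * A₂ := by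
    intro h hh
    obtain ⟨⟨a1, a2⟩, ⟨b1, b2⟩, -⟩ := hmem h hh
    have : |h.1 * h.2| ≤ (A₁ : ℤ) * A₂ := by
      rw [abs_mul]; exact mul_le_mul (abs_le.2 ⟨a1, a2⟩) (abs_le.2 ⟨b1, b2⟩) (abs_nonneg _) (by positivity)
    exact abs_le.1 this
  have hsrange : ∀ h ∈ S,
      sOf h ∈ Finset.Icc (-(((A₁ : ℤ) * A₂ + n₀) / c)) (((A₁ : ℤ) * A₂ - n₀) / c) := by
    intro h hh
    obtain ⟨hlo, hhi⟩ := habs h hh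
    have hp := hprod h hh
    rw [Finset.mem_Icc]
    constructor
    · -- `-(s) * c ≤ A₁A₂ + n₀`
      have h1 : -sOf h ≤ ((A₁ : ℤ) * A₂ + n₀) / c :=
        Int.le_ediv_of_mul_le hcz (by linarith)
      linarith
    · exact Int.le_ediv_of_mul_le hcz (by linarith)
  -- the target: pairs `(s, ±d)` with `d ∣ |n₀ + cs|`
  set T : Finset (ℤ × ℤ) := (Finset.Icc (-(((A₁ : ℤ) * A₂ + n₀) / c)) (((A₁ : ℤ) * A₂ - n₀) / c)).biUnion
    (fun s ↦ ((n₀ + c * s).natAbs.divisors.image (fun d : ℕ ↦ (s, (d : ℤ)))) ∪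
      ((n₀ + c * s).natAbs.divisors.image (fun d : ℕ ↦ (s, -(d : ℤ))))) with hT
  have hmaps : ∀ h ∈ S, (sOf h, h.1) ∈ T := by
    intro h hh
    rw [hT, Finset.mem_biUnion]
    refine ⟨sOf h, hsrange h hh, ?_⟩
    have hn0 : (n₀ + c * sOf h) ≠ 0 := by rw [← hprod h hh]; exact hne h hh
    have hdvd : h.1.natAbs ∈ (n₀ + c * sOf h).natAbs.divisors := by
      rw [Nat.mem_divisors]
      refine ⟨Int.natAbs_dvd_natAbs.2 ?_, Int.natAbs_ne_zero.2 hn0⟩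
      rw [← hprod h hh]; exact Dvd.intro _ rfl
    rw [Finset.mem_union, Finset.mem_image, Finset.mem_image]
    rcases le_or_gt 0 h.1 with hpos | hneg
    · left; exact ⟨h.1.natAbs, hdvd, by rw [Int.natAbs_of_nonneg hpos]⟩
    · right; refine ⟨h.1.natAbs, hdvd, ?_⟩
      rw [Int.ofNat_natAbs_of_nonpos hneg.le, neg_neg]
  have hinj : Set.InjOn (fun h : ℤ × ℤ ↦ (sOf h, h.1)) (S : Set (ℤ × ℤ)) := by
    intro h hh h' hh' he
    simp only [Prod.mk.injEq] at he
    obtain ⟨hs, h1⟩ := he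
    have hp := hprod h (Finset.mem_coe.1 hh)
    have hp' := hprod h' (Finset.mem_coe.1 hh')
    have : h.1 * h.2 = h.1 * h'.2 := by rw [hp, hs, ← hp', h1]
    exact Prod.ext h1 (mul_left_cancel₀ (h1ne h (Finset.mem_coe.1 hh)) this)
  have hcard := Finset.card_le_card_of_injOn (fun h : ℤ × ℤ ↦ (sOf h, h.1)) hmaps hinj
  refine hcard.trans ((Finset.card_biUnion_le).trans (Finset.sum_le_sum fun s _ ↦ ?_))
  calc _ ≤ ((n₀ + c * s).natAbs.divisors.image (fun d : ℕ ↦ (s, (d : ℤ)))).card +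
        ((n₀ + c * s).natAbs.divisors.image (fun d : ℕ ↦ (s, -(d : ℤ)))).card := Finset.card_union_le _ _
    _ ≤ (n₀ + c * s).natAbs.divisors.card + (n₀ + c * s).natAbs.divisors.card :=
        Nat.add_le_add Finset.card_image_le Finset.card_image_le
    _ = 2 * (n₀ + c * s).natAbs.divisors.card := by ring

/-- **The centred count with the divisor bound**: for `c ≥ 1`, `c ∤ n₀`, `τ(n) ≤ C·n^δ` (`δ ≥ 0`):
`#{(h₁,h₂) ∈ [-A₁,A₁]×[-A₂,A₂] : h₁h₂ ≡ n₀ (mod c)} ≤ (2A₁A₂/c + 1)·2C·(A₁A₂)^δ`, UNIFORMLY in `n₀`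
(on the range `|n₀ + cs| ≤ A₁A₂`). [cite: HardyWright2008, Theorem 315; KowalskiMichelVanderKam2000, Lemma 3.3 p. 9 — derivation] -/
theorem card_hyperbolaBox_le_centred (c : ℕ) (hc : 0 < c) (A₁ A₂ : ℕ) {n₀ : ℤ} (hn : ¬ (c : ℤ) ∣ n₀)
    {δ C : ℝ} (hδ : 0 ≤ δ) (hC : ∀ n : ℕ, ((n.divisors.card : ℕ) : ℝ) ≤ C * (n : ℝ) ^ δ) :
    ((((Finset.Icc (-(A₁ : ℤ)) A₁) ×ˢ (Finset.Icc (-(A₂ : ℤ)) A₂)).filter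
        (fun h : ℤ × ℤ ↦ ((h.1 * h.2 : ℤ) : ZMod c) = (n₀ : ZMod c))).card : ℝ) ≤
      (2 * ((A₁ : ℝ) * A₂) / c + 1) * (2 * C * ((A₁ : ℝ) * A₂) ^ δ) := by
  have hC0 : 0 ≤ C := by
    have h := hC 1
    simp at h
    linarith
  have hcz : (0 : ℤ) < c := by exact_mod_cast hc
  have hcr : (0 : ℝ) < c := by exact_mod_cast hc
  set a : ℤ := ((A₁ : ℤ) * A₂ + n₀) / c with ha
  set b : ℤ := ((A₁ : ℤ) * A₂ - n₀) / c with hb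
  have hcount := card_hyperbolaBox_le_sum_card_divisors_centred c hc A₁ A₂ hn
  -- on the range, `|n₀ + cs| ≤ A₁A₂`
  have hτ : ∀ s ∈ Finset.Icc (-a) b,
      (((n₀ + c * s).natAbs.divisors.card : ℕ) : ℝ) ≤ C * ((A₁ : ℝ) * A₂) ^ δ := by
    intro s hs
    rw [Finset.mem_Icc] at hs
    refine (hC _).trans (mul_le_mul_of_nonneg_left (Real.rpow_le_rpow (Nat.cast_nonneg _) ?_ hδ) hC0)
    have hup : n₀ + c * s ≤ (A₁ : ℤ) * A₂ := by
      have h1 : (c : ℤ) * s ≤ (c : ℤ) * b := mul_le_mul_of_nonneg_left hs.2 hcz.le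
      have h2 : (c : ℤ) * b ≤ (A₁ : ℤ) * A₂ - n₀ := by
        rw [mul_comm]; exact Int.ediv_mul_le _ hcz.ne'
      linarith
    have hlo : -((A₁ : ℤ) * A₂) ≤ n₀ + c * s := by
      have h1 : (c : ℤ) * (-a) ≤ (c : ℤ) * s := mul_le_mul_of_nonneg_left hs.1 hcz.le
      have h2 : (c : ℤ) * a ≤ (A₁ : ℤ) * A₂ + n₀ := by
        rw [mul_comm]; exact Int.ediv_mul_le _ hcz.ne'
      linarith
    have : ((n₀ + c * s).natAbs : ℤ) ≤ (A₁ : ℤ) * A₂ := by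
      rw [Int.natCast_natAbs]; exact abs_le.2 ⟨hlo, hup⟩
    exact_mod_cast this
  -- the number of `s`
  have hab : ((Finset.Icc (-a) b).card : ℝ) ≤ 2 * ((A₁ : ℝ) * A₂) / c + 1 := by
    rw [Int.card_Icc]
    have hb' : (b : ℝ) ≤ ((A₁ : ℝ) * A₂ - n₀) / c := by
      rw [le_div_iff₀ hcr]; exact_mod_cast Int.ediv_mul_le ((A₁ : ℤ) * A₂ - n₀) hcz.ne'
    have ha' : (a : ℝ) ≤ ((A₁ : ℝ) * A₂ + n₀) / c := by
      rw [le_div_iff₀ hcr]; exact_mod_cast Int.ediv_mul_le ((A₁ : ℤ) * A₂ + n₀) hcz.ne'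
    rcases le_or_gt 0 (b + 1 - -a) with hpos | hneg
    · have : (((b + 1 - -a).toNat : ℕ) : ℝ) = (b : ℝ) + 1 + a := by
        have e : (((b + 1 - -a).toNat : ℕ) : ℤ) = b + 1 - -a := Int.toNat_of_nonneg hpos
        have e' : (((b + 1 - -a).toNat : ℕ) : ℝ) = ((b + 1 - -a : ℤ) : ℝ) := by exact_mod_cast e
        rw [e']; push_cast; ring
      rw [this]
      have : (b : ℝ) + a ≤ 2 * ((A₁ : ℝ) * A₂) / c := by
        calc (b : ℝ) + a ≤ ((A₁ : ℝ) * A₂ - n₀) / c + ((A₁ : ℝ) * A₂ + n₀) / c := add_le_add hb' ha'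
          _ = 2 * ((A₁ : ℝ) * A₂) / c := by ring
      linarith
    · rw [Int.toNat_of_nonpos hneg.le, Nat.cast_zero]; positivity
  calc _ ≤ ((∑ s ∈ Finset.Icc (-a) b, 2 * ((n₀ + c * s).natAbs.divisors.card) : ℕ) : ℝ) := by
        exact_mod_cast hcount
    _ = ∑ s ∈ Finset.Icc (-a) b, 2 * (((n₀ + c * s).natAbs.divisors.card : ℕ) : ℝ) := by push_cast; rfl
    _ ≤ ∑ s ∈ Finset.Icc (-a) b, 2 * (C * ((A₁ : ℝ) * A₂) ^ δ) :=
        Finset.sum_le_sum fun s hs ↦ by linarith [hτ s hs]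
    _ = ((Finset.Icc (-a) b).card : ℝ) * (2 * C * ((A₁ : ℝ) * A₂) ^ δ) := by
        rw [Finset.sum_const, nsmul_eq_mul]; ring
    _ ≤ _ := mul_le_mul_of_nonneg_right hab (by positivity)

/-! ### §2. The multiplicities and the ledger with the centred count -/

section Ledger

variable {c : ℕ} [NeZero c]

/-- **`Σ_{box} N_c(a,b;h) ≤ gcd(a,c)·(2A₁A₂/c + 1)·2C(A₁A₂)^δ`** on every stratum, for `c ∤ ab`.
[cite: KowalskiMichelVanderKam2000, Lemma 3.3 p. 9 — derivation] -/
theorem sum_dualCount_box_le_centred (a b : ℕ) (hab : ¬ c ∣ a * b) (A₁ A₂ : ℕ)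
    {δ C : ℝ} (hδ : 0 ≤ δ) (hC : ∀ n : ℕ, ((n.divisors.card : ℕ) : ℝ) ≤ C * (n : ℝ) ^ δ) :
    ∑ h ∈ (Finset.Icc (-(A₁ : ℤ)) A₁) ×ˢ (Finset.Icc (-(A₂ : ℤ)) A₂),
        (dualCount c (a : ZMod c) (b : ZMod c) (h.1 : ZMod c) (h.2 : ZMod c) : ℝ) ≤
      (Nat.gcd a c : ℝ) * ((2 * ((A₁ : ℝ) * A₂) / c + 1) * (2 * C * ((A₁ : ℝ) * A₂) ^ δ)) := by
  classical
  have hc : 0 < c := Nat.pos_of_ne_zero (NeZero.ne c)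
  have hn : ¬ (c : ℤ) ∣ ((a * b : ℕ) : ℤ) := fun h ↦ hab (Int.natCast_dvd_natCast.1 h)
  have hcount := card_hyperbolaBox_le_centred c hc A₁ A₂ hn hδ hC
  set I := (Finset.Icc (-(A₁ : ℤ)) A₁) ×ˢ (Finset.Icc (-(A₂ : ℤ)) A₂) with hI
  calc ∑ h ∈ I, (dualCount c (a : ZMod c) (b : ZMod c) (h.1 : ZMod c) (h.2 : ZMod c) : ℝ)
      ≤ ∑ h ∈ I, (if ((h.1 * h.2 : ℤ) : ZMod c) = ((a * b : ℕ) : ZMod c) then (Nat.gcd a c : ℝ) else 0) :=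
        Finset.sum_le_sum fun h _ ↦ dualCount_natCast_le_gcd_ite a b h.1 h.2
    _ = (Nat.gcd a c : ℝ) *
          ((I.filter (fun h : ℤ × ℤ ↦ ((h.1 * h.2 : ℤ) : ZMod c) = (((a * b : ℕ) : ℤ) : ZMod c))).card : ℝ) := by
        rw [← Finset.sum_filter, Finset.sum_const, nsmul_eq_mul, mul_comm]
        push_cast; rfl
    _ ≤ _ := mul_le_mul_of_nonneg_left hcount (Nat.cast_nonneg _)

end Ledger

section Box

variable {q d₁ d₂ α β r : ℕ}

/-- **The trivial ledger of one truncated dual box, «bulk × density» form.** For `q, d₁, d₂, α, β ≥ 1`,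
`qr ≥ 1`, `qr ∤ αβ`, `J ≥ 0` bounding `|J₁|` on `x ≥ Z/2`, the divisor bound `τ(n) ≤ Cn^δ`, and all `A₁, A₂`:
`Σ_{(h₁,h₂) ∈ [-A₁,A₁]×[-A₂,A₂]} ‖Φ̂_i(h/(qr))‖·N_{qr}(α,β;h)
   ≤ bulk · gcd(α,qr) · (2A₁A₂/(qr) + 1) · 2C(A₁A₂)^δ`,
`bulk = (9/4)K₁K₂(d₁d₂K₁K₂/4)^{−1/2}W(d₁d₂K₁K₂/(4q̂²))r⁻¹J`. [cite: KowalskiMichelVanderKam2000, (21)–(23) p. 12 and Lemma 3.3 p. 9 — derivation] -/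
theorem sum_dualBox_norm_le_centred [NeZero q] [NeZero (q * r)] (hd₁ : 1 ≤ d₁) (hd₂ : 1 ≤ d₂) (hα : 1 ≤ α)
    (hβ : 1 ≤ β) (hndvd : ¬ q * r ∣ α * β) (i : ℕ × ℕ) {J : ℝ} (hJ0 : 0 ≤ J)
    (hJ : ∀ x : ℝ, 4 * π * Real.sqrt ((α : ℝ) * (β : ℝ) * ((2 : ℝ) ^ i.1 * 2 ^ i.2)) / ((q : ℝ) * r) / 2 ≤ x →
      |besselJ 1 x| ≤ J) {δ C : ℝ} (hδ : 0 ≤ δ) (hC : ∀ n : ℕ, ((n.divisors.card : ℕ) : ℝ) ≤ C * (n : ℝ) ^ δ)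
    (A₁ A₂ : ℕ) :
    ∑ h ∈ (Finset.Icc (-(A₁ : ℤ)) A₁) ×ˢ (Finset.Icc (-(A₂ : ℤ)) A₂),
        ‖fourier2 (boxWeight q d₁ d₂ α β r i) (h.1 / (q * r : ℕ)) (h.2 / (q * r : ℕ))‖ *
          (dualCount (q * r) (α : ZMod (q * r)) (β : ZMod (q * r)) (h.1 : ZMod (q * r)) (h.2 : ZMod (q * r)) : ℝ) ≤
      (9 / 4 * ((2 : ℝ) ^ i.1 * 2 ^ i.2) *
          (((d₁ : ℝ) * d₂ * ((2 : ℝ) ^ i.1 * 2 ^ i.2) / 4) ^ (-(1 / 2 : ℝ)) *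
            cutoffW ((d₁ : ℝ) * d₂ * ((2 : ℝ) ^ i.1 * 2 ^ i.2) / 4 / qhat q ^ 2) * (r : ℝ)⁻¹ * J)) *
        ((Nat.gcd α (q * r) : ℝ) *
          ((2 * ((A₁ : ℝ) * A₂) / (q * r : ℕ) + 1) * (2 * C * ((A₁ : ℝ) * A₂) ^ δ))) := by
  set B : ℝ := 9 / 4 * ((2 : ℝ) ^ i.1 * 2 ^ i.2) *
    (((d₁ : ℝ) * d₂ * ((2 : ℝ) ^ i.1 * 2 ^ i.2) / 4) ^ (-(1 / 2 : ℝ)) *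
      cutoffW ((d₁ : ℝ) * d₂ * ((2 : ℝ) ^ i.1 * 2 ^ i.2) / 4 / qhat q ^ 2) * (r : ℝ)⁻¹ * J) with hB
  have hB0 : 0 ≤ B := by
    have := cutoffW_nonneg ((d₁ : ℝ) * d₂ * ((2 : ℝ) ^ i.1 * 2 ^ i.2) / 4 / qhat q ^ 2)
    positivity
  have hbulk : ∀ h : ℤ × ℤ, ‖fourier2 (boxWeight q d₁ d₂ α β r i) (h.1 / (q * r : ℕ)) (h.2 / (q * r : ℕ))‖ ≤ B :=
    fun h ↦ norm_fourier2_boxWeight_le hd₁ hd₂ hα hβ i hJ0 hJ _ _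
  have hcount := sum_dualCount_box_le_centred (c := q * r) α β hndvd A₁ A₂ hδ hC
  calc _ ≤ ∑ h ∈ (Finset.Icc (-(A₁ : ℤ)) A₁) ×ˢ (Finset.Icc (-(A₂ : ℤ)) A₂),
          B * (dualCount (q * r) (α : ZMod (q * r)) (β : ZMod (q * r)) (h.1 : ZMod (q * r))
            (h.2 : ZMod (q * r)) : ℝ) :=
        Finset.sum_le_sum fun h _ ↦ mul_le_mul_of_nonneg_right (hbulk h) (Nat.cast_nonneg _)
    _ = B * ∑ h ∈ (Finset.Icc (-(A₁ : ℤ)) A₁) ×ˢ (Finset.Icc (-(A₂ : ℤ)) A₂),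
          (dualCount (q * r) (α : ZMod (q * r)) (β : ZMod (q * r)) (h.1 : ZMod (q * r))
            (h.2 : ZMod (q * r)) : ℝ) := by rw [Finset.mul_sum]
    _ ≤ _ := mul_le_mul_of_nonneg_left hcount hB0

end Box

end Summit.Parity.GeneralizedHardyLittlewood.Theorems.BeyondDiagonalBeatsQuarter.OffDiag
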